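import Mathlib

/-!
# utd-idea g53 — typed handles for the p = 3 Kolyvagin-system hypothesis audit on
`UniversalToricDescent.TwinAlgMuZeroAtThree` (stmt-BirchSwinnertonDyer-24254, β-road K2).

Howard 2004 (Compositio 140) Thm 1/2 assume `Gal(K̄/K) → Aut_{ℤ_p}(T_p E)` surjective; the wall/twin
hypothesis is only `HasSurjectiveModNGaloisRep 3`.  Howard uses full image only to verify his
H.1 (residual absolute irreducibility) and H.2 (`H¹(K(E[p^∞])/K, E[p]) = 0`), arXiv:1202.6340 p.12.
At `p = 3` both follow from mod-3 surjectivity: the finite core is `H¹(GL₂(𝔽₃), 𝔽₃²) = 0`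
(the central element `-1` acts by `-1`), and the pro-3 kernel has Frattini constituents only among
`{𝟙, Sym² V ⊗ det⁻¹}`, never `V`.  We type the finite core and the constituent statement.
-/

namespace Summit.BirchSwinnertonDyer.BirchSwinnertonDyer.Cruxes.TwinAlgMuZeroAtThree.KSAuditG53

open scoped Matrix

/-- The standard representation of `GL₂(𝔽₃)` on `𝔽₃²`. -/
noncomputable def std :
    Representation (ZMod 3) (GL (Fin 2) (ZMod 3)) (Fin 2 → ZMod 3) :=
  (Units.coeHom ((Fin 2 → ZMod 3) →ₗ[ZMod 3] (Fin 2 → ZMod 3))).comp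
    (Matrix.GeneralLinearGroup.toLin.toMonoidHom)

/-- Finite core of Howard's H.2 at `p = 3` under mod-3 surjectivity only:
`H¹(GL₂(𝔽₃), 𝔽₃²) = 0`. -/
def H1StdVanishes : Prop :=
  Subsingleton (groupCohomology.H1 (Rep.of std))

/-- The central involution `-1 ∈ GL₂(𝔽₃)` acts as `-1` on the standard module (the one-line reason
for `H1StdVanishes`: inflation–restriction along the centre, whose order `2` is prime to `3`). -/
def CentralMinusOneActs : Prop :=
  ∀ v : Fin 2 → ZMod 3, std (-1) v = -v

/-- Residual irreducibility used for Howard's H.1: no `GL₂(𝔽₃)`-stable line in `𝔽₃²`. -/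
def StdIrreducible : Prop :=
  ∀ W : Submodule (ZMod 3) (Fin 2 → ZMod 3), (∀ g : GL (Fin 2) (ZMod 3), W.map (std g) ≤ W) →
    W = ⊥ ∨ W = ⊤

/-- Frattini-layer statement behind the pro-3 step: the conjugation module `M₂(𝔽₃)` of `GL₂(𝔽₃)`
has no quotient (of a submodule) isomorphic to the standard module — typed as: there is no
`GL₂(𝔽₃)`-equivariant surjection from a `GL₂(𝔽₃)`-stable submodule of `M₂(𝔽₃)` (conjugation
action) onto `𝔽₃²` (standard action). -/
def NoStdConstituentInAdjoint : Prop :=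
  ∀ (W : Submodule (ZMod 3) (Matrix (Fin 2) (Fin 2) (ZMod 3)))
    (_hW : ∀ g : GL (Fin 2) (ZMod 3), ∀ X ∈ W, (g : Matrix (Fin 2) (Fin 2) (ZMod 3)) * X *
      ((g⁻¹ : GL (Fin 2) (ZMod 3)) : Matrix (Fin 2) (Fin 2) (ZMod 3)) ∈ W)
    (f : W →ₗ[ZMod 3] (Fin 2 → ZMod 3)),
    (∀ g : GL (Fin 2) (ZMod 3), ∀ X : W,
      f ⟨(g : Matrix (Fin 2) (Fin 2) (ZMod 3)) * (X : Matrix (Fin 2) (Fin 2) (ZMod 3)) *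
        ((g⁻¹ : GL (Fin 2) (ZMod 3)) : Matrix (Fin 2) (Fin 2) (ZMod 3)), _hW g X X.2⟩ =
        std g (f X)) →
    ¬ Function.Surjective f

/-- sanity: the central action statement is decidable arithmetic. -/
theorem centralMinusOneActs_holds : CentralMinusOneActs := by
  intro v
  unfold std
  ext i
  simp [Matrix.GeneralLinearGroup.toLin]

end Summit.BirchSwinnertonDyer.BirchSwinnertonDyer.Cruxes.TwinAlgMuZeroAtThree.KSAuditG53
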